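import Mathlib
import HarnessLib
import Summits.HodgeConjecture.HodgeConjecture.Theses.EndoscopicMiddleDegree

/-!
# Crux-ideate sketch (ideator 3, round 1) for `IsotypicMiddleClassesAlgebraic` (stmt-HodgeConjecture-14301)

Card `hecke-self-correlation-detectors`. First lemma = the DETECTION PRINCIPLE: for a rational,
idempotent, self-adjoint, algebraic-class-preserving projector `P` on `H²ᵖ(X(ℂ);ℂ)` whose rational
fixed classes form an ANISOTROPIC lattice for a ℚ-valued symmetric pairing (Hodge–Riemann on a pure
primitive piece), algebraicity of ALL rational `P`-fixed classes follows from DETECTION — every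
non-zero rational `P`-fixed class pairs non-trivially with SOME algebraic class. Pure linear algebra
over the tree's carriers (provable now); it is the formal hinge that turns one positive Hecke
self-correlation number of one non-equivariant cycle into the crux for that piece.
-/

set_option linter.dupNamespace false

namespace Summit.HodgeConjecture.HodgeConjecture.Cruxes.IsotypicMiddleClassesAlgebraic.IdeatorThree

open scoped BigOperators
open Literature.AlgebraicGeometry.HodgeTheory

/-- DETECTION PRINCIPLE (first lemma of card `hecke-self-correlation-detectors`).
Data: a degree `2p` on a complex scheme `X`, a `ℂ`-bilinear pairing `pair` on `H²ᵖ(X(ℂ);ℂ)` (intended: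
`(a,b) ↦ tr(a ∪ b)`), a `ℂ`-linear `P` (intended: the action of the crux's correspondence `γ`, made
self-adjoint/idempotent by polynomial calculus in `γ`, `γᵗ`).
Hypotheses (all true for the intended data, each a classical fact): rational classes have a finite
ℚ-basis that is ℂ-free (universal coefficients); algebraic classes are ℂ-spanned by RATIONAL algebraic
classes (cycle classes are rational); `pair` symmetric and ℚ-valued on rational classes; `P` idempotent,
rational, self-adjoint for `pair`, preserves algebraic classes; ANISOTROPY of `pair` on rational `P`-fixed
classes (Hodge–Riemann when `Im P` is pure `(p,p)` and primitive); DETECTION (every non-zero rational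
`P`-fixed class pairs non-trivially with some algebraic class).
Conclusion: every rational `P`-fixed class is algebraic.
Proof (paper): `F` := rational `P`-fixed classes (finite-dimensional ℚ-space), `A' := F ∩ Alg`;
anisotropy ⟹ `F = A' ⊕ A'^⊥`; for `c = a + e`, self-adjointness + `P(Alg_ℚ) ⊆ A'` give `e ⊥ Alg`,
so detection forces `e = 0`. -/
def DetectionPrinciple : Prop :=
  ∀ (X : Literature.AlgebraicGeometry.Motives.SchemeOver ℂ) (p : ℕ)
    (pair : complexBetti X (2 * p) →ₗ[ℂ] complexBetti X (2 * p) →ₗ[ℂ] ℂ)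
    (P : complexBetti X (2 * p) →ₗ[ℂ] complexBetti X (2 * p)),
    -- (UC) rational classes: a finite ℚ-spanning family that is ℂ-linearly independent
    (∃ s : Finset (complexBetti X (2 * p)),
        (∀ x ∈ s, IsRationalClass x) ∧
        LinearIndependent ℂ (fun x : (s : Set (complexBetti X (2 * p))) => (x : complexBetti X (2 * p))) ∧
        ∀ c, IsRationalClass c → ∃ q : complexBetti X (2 * p) → ℚ,
          c = ∑ x ∈ s, ((q x : ℚ) : ℂ) • x) →
    -- (ALGℚ) algebraic classes are ℂ-spanned by rational algebraic classes
    (∀ a ∈ algebraicClasses X p,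
        a ∈ Submodule.span ℂ {z : complexBetti X (2 * p) | z ∈ algebraicClasses X p ∧ IsRationalClass z}) →
    -- (SYM) + (RATℚ): symmetric pairing, ℚ-valued on rational classes
    (∀ a b, pair a b = pair b a) →
    (∀ a b, IsRationalClass a → IsRationalClass b → pair a b ∈ Set.range (algebraMap ℚ ℂ)) →
    -- (PROJ) P idempotent, rational, self-adjoint, preserves algebraic classes
    (P ∘ₗ P = P) →
    (∀ β, IsRationalClass β → IsRationalClass (P β)) →
    (∀ a b, pair (P a) b = pair a (P b)) →
    (∀ a ∈ algebraicClasses X p, P a ∈ algebraicClasses X p) →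
    -- (HR) anisotropy on rational P-fixed classes
    (∀ c, IsRationalClass c → P c = c → pair c c = 0 → c = 0) →
    -- (DET) detection by algebraic classes
    (∀ c, IsRationalClass c → P c = c → c ≠ 0 → ∃ z ∈ algebraicClasses X p, pair c z ≠ 0) →
    ∀ c, IsRationalClass c → P c = c → c ∈ algebraicClasses X p

/-- SINGLE-DETECTOR FORM (what the card actually needs per Hecke×Galois-irreducible piece): if, in
addition, the rational `P`-fixed classes are CYCLIC for a family `T` of pair-adjointable operators that
commute with `P` and preserve algebraic classes (intended: Hecke correspondences and their
transposes — algebraic, BMM Thm 61), then ONE algebraic class `z` with `P z ≠ 0` detects everything: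
`{c : pair c (Alg) = 0}` is `T`-stable, so it is `0` or everything, and `P z ∈ Alg ∩ Im P`, `pair (P z) (P z)
≠ 0` excludes "everything". Stated as an implication to be combined with `DetectionPrinciple`. -/
def SingleDetectorSuffices : Prop :=
  ∀ (X : Literature.AlgebraicGeometry.Motives.SchemeOver ℂ) (p : ℕ)
    (pair : complexBetti X (2 * p) →ₗ[ℂ] complexBetti X (2 * p) →ₗ[ℂ] ℂ)
    (P : complexBetti X (2 * p) →ₗ[ℂ] complexBetti X (2 * p))
    (ι : Type) (T Tt : ι → (complexBetti X (2 * p) →ₗ[ℂ] complexBetti X (2 * p))),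
    (∀ a b, pair a b = pair b a) →
    (P ∘ₗ P = P) → (∀ β, IsRationalClass β → IsRationalClass (P β)) →
    (∀ a b, pair (P a) b = pair a (P b)) →
    (∀ a ∈ algebraicClasses X p, P a ∈ algebraicClasses X p) →
    -- Hecke family: adjoints Tt, commuting with P, preserving algebraic and rational classes
    (∀ i a b, pair (T i a) b = pair a (Tt i b)) →
    (∀ i, T i ∘ₗ P = P ∘ₗ T i) → (∀ i, Tt i ∘ₗ P = P ∘ₗ Tt i) →
    (∀ i, ∀ a ∈ algebraicClasses X p, T i a ∈ algebraicClasses X p ∧ Tt i a ∈ algebraicClasses X p) →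
    (∀ i β, IsRationalClass β → IsRationalClass (T i β) ∧ IsRationalClass (Tt i β)) →
    -- cyclicity (irreducibility of the piece): every non-zero rational P-fixed class generates all of them
    (∀ c c', IsRationalClass c → P c = c → c ≠ 0 → IsRationalClass c' → P c' = c' →
        ∃ (t : Finset ι) (q : ι → ℚ), c' = ∑ i ∈ t, ((q i : ℚ) : ℂ) • T i c) →
    -- anisotropy
    (∀ c, IsRationalClass c → P c = c → pair c c = 0 → c = 0) →
    -- ONE detector
    (∃ z ∈ algebraicClasses X p, IsRationalClass z ∧ P z ≠ 0) →
    ∀ c, IsRationalClass c → P c = c → c ≠ 0 → ∃ z ∈ algebraicClasses X p, pair c z ≠ 0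

end Summit.HodgeConjecture.HodgeConjecture.Cruxes.IsotypicMiddleClassesAlgebraic.IdeatorThree
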